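import Summits.Schanuel.Schanuel.Theorems.ZilberEacDensityLift
import HarnessLib

/-!
# The density lift `W_e(S)`, II: torus part, fibration, base, freeness

Zilber's Exponential-Algebraic Closedness, case ladder (host summit Schanuel, cell `pub-schanuel`,
seat 2, gen 6).  Continuation of `ZilberEacDensityLift`: for `S ⊆ ℂ^d × ℂ^d` irreducible meeting
the torus and `e ∉ I(S)`, the torus part of the lift `W_e(S) = {s ∈ S, y_last = x_last · e(s)}` is
`{liftPt e s x : s ∈ U, x ≠ 0}` over the dense open `U = {s ∈ S ∩ G^d : e(s) ≠ 0}` of `S`, and: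

* `zariskiDim_image_dropLastMat_liftVar` — `dim cl[Δ_d](W_e(S) ∩ Gⁿ) = dim S` (the fibration
  binder of `ECCellPeriodicStdFib`);
* `isPeriodVec_projAdd_liftVar`, `addProjDim_liftVar` — the base `π(W_e(S) ∩ Gⁿ)` is the cylinder
  `π(U) × ℂˣ`: it has period `e_last` and `addProjDim W_e(S) = addProjDim S + 1`;
* `isAddFree_liftVar`, `isMulFree_liftVar` — additive / multiplicative freeness of `S ∩ G^d` lift
  (the new coordinate `x_last` is free, and `y_last = x_last · e` moves with it).

Elementary; the density of `U` in `S` (`vanishingIdeal_inter_torusLocus_inter_ne`) transfers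
relations from `U` to `S ∩ G^d`.

HONEST FRAMING: bookkeeping towards `ECCellPeriodicStdFib 2 ↔ free Mantova–Masser density`;
`EC(3,2)` OPEN; nothing here bears on Schanuel's conjecture (EAC ⇏ SC).
-/

noncomputable section

open MvPolynomial
open Literature.NumberTheory.Transcendental Literature.ModelTheory.Zilber

set_option linter.dupNamespace false

namespace Summit.Schanuel.Schanuel.Theorems

variable {d : ℕ} (e : MvPolynomial (Fin d ⊕ Fin d) ℂ) {S : Set (Fin d ⊕ Fin d → ℂ)}

/-! ## The torus part of the lift -/

/-- `liftPt e s x` is a torus point iff `s` is and `x · e(s) ≠ 0`. [folklore] -/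
theorem liftPt_mem_torusLocus_iff (s : Fin d ⊕ Fin d → ℂ) (x : ℂ) :
    liftPt e s x ∈ torusLocus ℂ (d + 1) ↔
      s ∈ torusLocus ℂ d ∧ x ≠ 0 ∧ MvPolynomial.eval s e ≠ 0 := by
  rw [mem_torusLocus_iff, mem_torusLocus_iff, Fin.forall_fin_succ']
  simp only [liftPt_inr_castSucc, liftPt_inr_last, mul_ne_zero_iff]

/-- **The torus part of `W_e(S)`** consists of the `liftPt e s x` with `s ∈ U = {s ∈ S ∩ G^d : e(s) ≠ 0}`
and `x ≠ 0`. [folklore] -/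
theorem mem_liftVar_inter_torusLocus_iff {w : Fin (d + 1) ⊕ Fin (d + 1) → ℂ} :
    w ∈ liftVar e S ∩ torusLocus ℂ (d + 1) ↔
      ∃ s ∈ S ∩ torusLocus ℂ d ∩ {s | MvPolynomial.eval s e ≠ 0}, ∃ x : ℂ, x ≠ 0 ∧ w = liftPt e s x := by
  constructor
  · rintro ⟨hw, hT⟩
    obtain ⟨s, hs, x, rfl⟩ := (mem_liftVar_iff e).1 hw
    obtain ⟨hsT, hx, hes⟩ := (liftPt_mem_torusLocus_iff e s x).1 hT
    exact ⟨s, ⟨⟨hs, hsT⟩, hes⟩, x, hx, rfl⟩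
  · rintro ⟨s, ⟨⟨hs, hsT⟩, hes⟩, x, hx, rfl⟩
    exact ⟨(liftPt_mem_liftVar_iff e s x).2 hs, (liftPt_mem_torusLocus_iff e s x).2 ⟨hsT, hx, hes⟩⟩

/-- `liftPt e s x` lies in the torus part for `s ∈ U`, `x ≠ 0`. [folklore] -/
theorem liftPt_mem_liftVar_inter_torusLocus {s : Fin d ⊕ Fin d → ℂ}
    (hs : s ∈ S ∩ torusLocus ℂ d ∩ {s | MvPolynomial.eval s e ≠ 0}) {x : ℂ} (hx : x ≠ 0) :
    liftPt e s x ∈ liftVar e S ∩ torusLocus ℂ (d + 1) :=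
  (mem_liftVar_inter_torusLocus_iff e).2 ⟨s, hs, x, hx, rfl⟩

/-- **The projection of the torus part is `U`.** [folklore] -/
theorem image_pr_liftVar_inter_torusLocus :
    (fun (w : Fin (d + 1) ⊕ Fin (d + 1) → ℂ) (t : Fin d ⊕ Fin d) =>
        w (Sum.map Fin.castSucc Fin.castSucc t)) '' (liftVar e S ∩ torusLocus ℂ (d + 1)) =
      S ∩ torusLocus ℂ d ∩ {s | MvPolynomial.eval s e ≠ 0} := by
  ext s
  constructor
  · rintro ⟨w, hw, rfl⟩
    obtain ⟨s, hs, x, -, rfl⟩ := (mem_liftVar_inter_torusLocus_iff e).1 hw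
    beta_reduce
    rwa [pr_liftPt]
  · intro hs
    exact ⟨liftPt e s 1, liftPt_mem_liftVar_inter_torusLocus e hs one_ne_zero, pr_liftPt e s 1⟩

/-! ## `U` is dense in `S` -/

/-- **`U = {s ∈ S ∩ G^d : e(s) ≠ 0}` is Zariski dense in `S`**: for `I(S)` prime, `S ∩ G^d ≠ ∅` and
`e ∉ I(S)`, a polynomial vanishing on `U` vanishes on `S` (`p · e · ∏ yᵢ ∈ I(S)`). [folklore] -/
theorem vanishingIdeal_inter_torusLocus_inter_ne (hS : (vanishingIdeal ℂ S).IsPrime)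
    (hne : (S ∩ torusLocus ℂ d).Nonempty) (he : e ∉ vanishingIdeal ℂ S) :
    vanishingIdeal ℂ (S ∩ torusLocus ℂ d ∩ {s | MvPolynomial.eval s e ≠ 0}) = vanishingIdeal ℂ S := by
  refine le_antisymm ?_ (vanishingIdeal_anti_mono fun s hs => hs.1.1)
  intro p hp
  have hprod : (∏ i, X (Sum.inr i) : MvPolynomial (Fin d ⊕ Fin d) ℂ) ∉ vanishingIdeal ℂ S := by
    obtain ⟨z, hzS, hzT⟩ := hne
    intro h
    have := (mem_vanishingIdeal_iff.1 h) z hzS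
    rw [map_prod] at this
    simp only [aeval_X] at this
    exact (Finset.prod_ne_zero_iff.2 fun i _ => hzT i) this
  have hmem : p * (e * ∏ i, X (Sum.inr i)) ∈ vanishingIdeal ℂ S := by
    rw [mem_vanishingIdeal_iff]
    intro z hz
    rw [map_mul, map_mul, map_prod]
    simp only [aeval_X]
    by_cases hzT : z ∈ torusLocus ℂ d
    · by_cases hez : MvPolynomial.eval z e = 0
      · rw [show aeval z e = MvPolynomial.eval z e from rfl, hez, zero_mul, mul_zero]
      · rw [(mem_vanishingIdeal_iff.1 hp) z ⟨⟨hz, hzT⟩, hez⟩, zero_mul]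
    · simp only [mem_torusLocus_iff, not_forall, not_not] at hzT
      obtain ⟨i, hi⟩ := hzT
      rw [Finset.prod_eq_zero (Finset.mem_univ i) hi, mul_zero, mul_zero]
  rcases hS.mem_or_mem hmem with h | h
  · exact h
  · rcases hS.mem_or_mem h with h | h
    · exact (he h).elim
    · exact (hprod h).elim

/-- `U` is nonempty (its vanishing ideal is the proper ideal `I(S)`). [folklore] -/
theorem inter_torusLocus_inter_ne_nonempty (hS : (vanishingIdeal ℂ S).IsPrime)
    (hne : (S ∩ torusLocus ℂ d).Nonempty) (he : e ∉ vanishingIdeal ℂ S) :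
    (S ∩ torusLocus ℂ d ∩ {s | MvPolynomial.eval s e ≠ 0}).Nonempty := by
  by_contra h
  rw [Set.not_nonempty_iff_eq_empty] at h
  have := vanishingIdeal_inter_torusLocus_inter_ne e hS hne he
  rw [h, vanishingIdeal_empty] at this
  exact hS.ne_top this.symm

/-- The torus part of the lift is nonempty. [folklore] -/
theorem liftVar_inter_torusLocus_nonempty (hS : (vanishingIdeal ℂ S).IsPrime)
    (hne : (S ∩ torusLocus ℂ d).Nonempty) (he : e ∉ vanishingIdeal ℂ S) :
    (liftVar e S ∩ torusLocus ℂ (d + 1)).Nonempty := by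
  obtain ⟨s, hs⟩ := inter_torusLocus_inter_ne_nonempty e hS hne he
  exact ⟨_, liftPt_mem_liftVar_inter_torusLocus e hs one_ne_zero⟩

/-! ## The fibration binder: `dim cl[Δ_d](W_e(S) ∩ Gⁿ) = dim S` -/

/-- **`dim cl[Δ_d](W_e(S) ∩ Gⁿ) = dim S`**: the projection of the torus part is the dense subset
`U` of `S`. [folklore] -/
theorem zariskiDim_image_dropLastMat_liftVar (hS : IsIrreducibleClosed ℂ S)
    (hne : (S ∩ torusLocus ℂ d).Nonempty) (he : e ∉ vanishingIdeal ℂ S) :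
    zariskiDim ℂ (matrixAct (dropLastMat d) '' (liftVar e S ∩ torusLocus ℂ (d + 1))) =
      zariskiDim ℂ S := by
  rw [← zariskiDim_projClosure_eq (isIrreducibleClosed_liftVar e hS)
      (liftVar_inter_torusLocus_nonempty e hS.2 hne he),
    zariskiDim_zeroLocus_vanishingIdeal, image_pr_liftVar_inter_torusLocus]
  unfold zariskiDim
  rw [vanishingIdeal_inter_torusLocus_inter_ne e hS.2 hne he]

/-! ## The base `π(W_e(S) ∩ Gⁿ) = π(U) × ℂˣ` -/

/-- Points of the base: `(π s, x)` with `s ∈ U`, `x ≠ 0`. [folklore] -/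
theorem mem_projAdd_image_liftVar_iff {v : Fin (d + 1) → ℂ} :
    v ∈ projAdd '' (liftVar e S ∩ torusLocus ℂ (d + 1)) ↔
      ∃ s ∈ S ∩ torusLocus ℂ d ∩ {s | MvPolynomial.eval s e ≠ 0}, ∃ x : ℂ, x ≠ 0 ∧
        v = Fin.snoc (projAdd s) x := by
  constructor
  · rintro ⟨w, hw, rfl⟩
    obtain ⟨s, hs, x, hx, rfl⟩ := (mem_liftVar_inter_torusLocus_iff e).1 hw
    exact ⟨s, hs, x, hx, projAdd_liftPt e s x⟩
  · rintro ⟨s, hs, x, hx, rfl⟩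
    exact ⟨_, liftPt_mem_liftVar_inter_torusLocus e hs hx, projAdd_liftPt e s x⟩

/-- A polynomial vanishing on the base vanishes on the whole line `{(π s, t) : t ∈ ℂ}` over each
`s ∈ U` (it vanishes there for all `t ≠ 0`, an infinite set). [folklore] -/
theorem eval_snoc_eq_zero_of_mem_vanishingIdeal_projAdd_liftVar {p : MvPolynomial (Fin (d + 1)) ℂ}
    (hp : p ∈ vanishingIdeal ℂ (projAdd '' (liftVar e S ∩ torusLocus ℂ (d + 1))))
    {s : Fin d ⊕ Fin d → ℂ} (hs : s ∈ S ∩ torusLocus ℂ d ∩ {s | MvPolynomial.eval s e ≠ 0}) (t : ℂ) :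
    MvPolynomial.eval (Fin.snoc (projAdd s) t : Fin (d + 1) → ℂ) p = 0 := by
  set q : Polynomial ℂ :=
    (MvPolynomial.optionEquivLeft ℂ (Fin d) (rename finSuccEquivLast p)).map
      (MvPolynomial.eval (projAdd s)) with hq
  have hroots : ∀ x : ℂ, x ≠ 0 → q.IsRoot x := by
    intro x hx
    rw [Polynomial.IsRoot.def, hq, ← eval_snoc_eq_eval_map]
    exact (mem_vanishingIdeal_iff.1 hp) _ ((mem_projAdd_image_liftVar_iff e).2 ⟨s, hs, x, hx, rfl⟩)
  have hq0 : q = 0 := by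
    refine Polynomial.eq_zero_of_infinite_isRoot q ?_
    exact ((Set.finite_singleton (0 : ℂ)).infinite_compl).mono fun x hx => hroots x hx
  rw [eval_snoc_eq_eval_map, ← hq, hq0, Polynomial.eval_zero]

/-- **The base has period `e_last`.** [folklore] -/
theorem isPeriodVec_projAdd_liftVar :
    IsPeriodVec ℂ (projAdd '' (liftVar e S ∩ torusLocus ℂ (d + 1))) (Pi.single (Fin.last d) 1) := by
  intro p hp
  rw [mem_vanishingIdeal_iff]
  intro v hv
  obtain ⟨s, hs, x, -, rfl⟩ := (mem_projAdd_image_liftVar_iff e).1 hv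
  change MvPolynomial.eval _ (transl _ p) = 0
  rw [eval_transl]
  have hv' : ((Fin.snoc (projAdd s) x : Fin (d + 1) → ℂ) + fun i =>
      ((Pi.single (Fin.last d) (1 : ℤ) : Fin (d + 1) → ℤ) i : ℂ)) =
      Fin.snoc (projAdd s) (x + 1) := by
    funext j
    rcases Fin.eq_castSucc_or_eq_last j with ⟨i, rfl⟩ | rfl
    · rw [Pi.add_apply, Fin.snoc_castSucc, Fin.snoc_castSucc, Pi.single_apply,
        if_neg (Fin.castSucc_ne_last i), Int.cast_zero, add_zero]
    · rw [Pi.add_apply, Fin.snoc_last, Fin.snoc_last, Pi.single_eq_same, Int.cast_one]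
  rw [hv']
  exact eval_snoc_eq_zero_of_mem_vanishingIdeal_projAdd_liftVar e hp hs (x + 1)

/-- **The cross-section of the base is `cl π(S ∩ G^d)`**: `I(π(W_e(S) ∩ Gⁿ)) ∩ ℂ[x'] = I(π(S ∩ G^d))`.
[folklore] -/
theorem comap_vanishingIdeal_projAdd_liftVar (hS : IsIrreducibleClosed ℂ S)
    (hne : (S ∩ torusLocus ℂ d).Nonempty) (he : e ∉ vanishingIdeal ℂ S) :
    (vanishingIdeal ℂ (projAdd '' (liftVar e S ∩ torusLocus ℂ (d + 1)))).comap
        (rename (R := ℂ) (Fin.castSucc (n := d)) :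
          MvPolynomial (Fin d) ℂ →+* MvPolynomial (Fin (d + 1)) ℂ) =
      vanishingIdeal ℂ (projAdd '' (S ∩ torusLocus ℂ d)) := by
  have hU : vanishingIdeal ℂ (projAdd '' (S ∩ torusLocus ℂ d ∩ {s | MvPolynomial.eval s e ≠ 0})) =
      vanishingIdeal ℂ (projAdd '' (S ∩ torusLocus ℂ d)) := by
    rw [vanishingIdeal_image_projAdd, vanishingIdeal_image_projAdd,
      vanishingIdeal_inter_torusLocus_inter_ne e hS.2 hne he, vanishingIdeal_inter_torusLocus hS hne]
  rw [← hU]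
  ext c
  rw [Ideal.mem_comap, mem_vanishingIdeal_iff, mem_vanishingIdeal_iff]
  constructor
  · intro h
    rintro _ ⟨s, hs, rfl⟩
    have := h _ ((mem_projAdd_image_liftVar_iff e).2 ⟨s, hs, 1, one_ne_zero, rfl⟩)
    change MvPolynomial.eval _ (rename Fin.castSucc c) = 0 at this
    rw [eval_rename] at this
    have hc : (Fin.snoc (projAdd s) (1 : ℂ) : Fin (d + 1) → ℂ) ∘ Fin.castSucc = projAdd s := by
      funext i
      exact Fin.snoc_castSucc (α := fun _ => ℂ) _ _ i
    rw [hc] at this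
    exact this
  · intro h v hv
    obtain ⟨s, hs, x, -, rfl⟩ := (mem_projAdd_image_liftVar_iff e).1 hv
    change MvPolynomial.eval _ (rename Fin.castSucc c) = 0
    rw [eval_rename]
    have hc : (Fin.snoc (projAdd s) x : Fin (d + 1) → ℂ) ∘ Fin.castSucc = projAdd s := by
      funext i
      exact Fin.snoc_castSucc (α := fun _ => ℂ) _ _ i
    rw [hc]
    exact h _ ⟨s, hs, rfl⟩

/-- **`addProjDim W_e(S) = addProjDim S + 1`** (the base is a cylinder over `cl π(S ∩ G^d)`).
[folklore] -/
theorem addProjDim_liftVar (hS : IsIrreducibleClosed ℂ S)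
    (hne : (S ∩ torusLocus ℂ d).Nonempty) (he : e ∉ vanishingIdeal ℂ S) :
    addProjDim ℂ (d + 1) (liftVar e S) = addProjDim ℂ d S + 1 := by
  haveI : Infinite ℂ := Infinite.of_injective _ Nat.cast_injective
  unfold addProjDim zariskiDim
  rw [ringKrullDim_quotient_eq_of_isPeriodVec (isPeriodVec_projAdd_liftVar e),
    comap_vanishingIdeal_projAdd_liftVar e hS hne he]

/-! ## Freeness -/

/-- The `ℤ`-linear form of `m` at `liftPt e s x` splits off the last coordinate. [folklore] -/
theorem sum_liftPt_inl (m : Fin (d + 1) → ℤ) (s : Fin d ⊕ Fin d → ℂ) (x : ℂ) :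
    (∑ j, (m j : ℂ) * liftPt e s x (Sum.inl j)) =
      (∑ i : Fin d, (m (Fin.castSucc i) : ℂ) * s (Sum.inl i)) + (m (Fin.last d) : ℂ) * x := by
  rw [Fin.sum_univ_castSucc]
  simp only [liftPt_inl_castSucc, liftPt_inl_last]

/-- The monomial of `m` at `liftPt e s x` splits off the last coordinate. [folklore] -/
theorem prod_liftPt_inr (m : Fin (d + 1) → ℤ) (s : Fin d ⊕ Fin d → ℂ) (x : ℂ) :
    (∏ j, liftPt e s x (Sum.inr j) ^ m j) =
      (∏ i : Fin d, s (Sum.inr i) ^ m (Fin.castSucc i)) *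
        (x * MvPolynomial.eval s e) ^ m (Fin.last d) := by
  rw [Fin.prod_univ_castSucc]
  simp only [liftPt_inr_castSucc, liftPt_inr_last]

/-- A nonzero `m ∈ ℤ^{d+1}` with `m_last = 0` restricts to a nonzero vector of `ℤ^d`. [folklore] -/
theorem castSucc_ne_zero_of_last_eq_zero {m : Fin (d + 1) → ℤ} (hm : m ≠ 0)
    (hml : m (Fin.last d) = 0) : (fun i : Fin d => m (Fin.castSucc i)) ≠ 0 := by
  intro h
  apply hm
  funext j
  rcases Fin.eq_castSucc_or_eq_last j with ⟨i, rfl⟩ | rfl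
  · exact congrFun h i
  · exact hml

/-- **Additive freeness lifts**: if `S ∩ G^d` is additively free then so is `W_e(S) ∩ Gⁿ`
(a relation involving `x_last` is refuted by moving `x_last`; one not involving it restricts to `U`,
dense in `S`). [folklore] -/
theorem isAddFree_liftVar (hS : IsIrreducibleClosed ℂ S) (hne : (S ∩ torusLocus ℂ d).Nonempty)
    (he : e ∉ vanishingIdeal ℂ S) (hadd : IsAddFree ℂ d (S ∩ torusLocus ℂ d)) :
    IsAddFree ℂ (d + 1) (liftVar e S ∩ torusLocus ℂ (d + 1)) := by
  intro m hm
  rintro ⟨c, hc⟩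
  obtain ⟨s₀, hs₀⟩ := inter_torusLocus_inter_ne_nonempty e hS.2 hne he
  by_cases hml : m (Fin.last d) = 0
  · -- restrict to `U` and transfer to `S ∩ G^d` through `I(U) = I(S)`
    set m' : Fin d → ℤ := fun i => m (Fin.castSucc i) with hm'
    refine hadd m' (castSucc_ne_zero_of_last_eq_zero hm hml) ⟨c, fun z hz => ?_⟩
    set L : MvPolynomial (Fin d ⊕ Fin d) ℂ := (∑ i, C (m' i : ℂ) * X (Sum.inl i)) - C c with hL
    have hLU : L ∈ vanishingIdeal ℂ (S ∩ torusLocus ℂ d ∩ {s | MvPolynomial.eval s e ≠ 0}) := by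
      rw [mem_vanishingIdeal_iff]
      intro u hu
      have h1 := hc _ (liftPt_mem_liftVar_inter_torusLocus e hu one_ne_zero)
      rw [sum_liftPt_inl, hml, Int.cast_zero, zero_mul, add_zero] at h1
      rw [hL, map_sub, map_sum, aeval_C, sub_eq_zero]
      simp only [map_mul, aeval_C, aeval_X]
      exact h1
    rw [vanishingIdeal_inter_torusLocus_inter_ne e hS.2 hne he] at hLU
    have h2 := (mem_vanishingIdeal_iff.1 hLU) z hz.1
    rw [hL, map_sub, map_sum, aeval_C, sub_eq_zero] at h2
    simp only [map_mul, aeval_C, aeval_X] at h2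
    exact h2
  · -- move `x_last`: the points over `s₀` with `x = 1` and `x = 2`
    have h1 := hc _ (liftPt_mem_liftVar_inter_torusLocus e hs₀ one_ne_zero)
    have h2 := hc _ (liftPt_mem_liftVar_inter_torusLocus e hs₀ two_ne_zero)
    rw [sum_liftPt_inl] at h1 h2
    have : (m (Fin.last d) : ℂ) = 0 := by linear_combination h2 - h1
    exact hml (by exact_mod_cast this)

/-- Laurent monomials in the `y`-coordinates as quotients of honest monomials:
`∏ yᵢ^{mᵢ} · ∏ yᵢ^{(-mᵢ)⁺} = ∏ yᵢ^{mᵢ⁺}` on the torus. [folklore] -/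
theorem prod_zpow_mul_prod_pow_eq (m : Fin d → ℤ) {z : Fin d ⊕ Fin d → ℂ} (hz : z ∈ torusLocus ℂ d) :
    (∏ i, z (Sum.inr i) ^ m i) * (∏ i, z (Sum.inr i) ^ (-(m i)).toNat) =
      ∏ i, z (Sum.inr i) ^ (m i).toNat := by
  rw [← Finset.prod_mul_distrib]
  refine Finset.prod_congr rfl fun i _ => ?_
  rw [← zpow_natCast, ← zpow_natCast, ← zpow_add₀ (hz i)]
  congr 1
  have := Int.toNat_sub_toNat_neg (m i)
  omega

/-- **Multiplicative freeness lifts**: if `S ∩ G^d` is multiplicatively free then so is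
`W_e(S) ∩ Gⁿ` (a monomial involving `y_last = x_last · e(s)` is moved by `x_last`; one not involving it
is a Laurent relation on `U`, which clears to a polynomial relation, transfers to `S` by density, and
descends to `S ∩ G^d`). [folklore] -/
theorem isMulFree_liftVar (hS : IsIrreducibleClosed ℂ S) (hne : (S ∩ torusLocus ℂ d).Nonempty)
    (he : e ∉ vanishingIdeal ℂ S) (hmul : IsMulFree ℂ d (S ∩ torusLocus ℂ d)) :
    IsMulFree ℂ (d + 1) (liftVar e S ∩ torusLocus ℂ (d + 1)) := by
  intro m hm
  rintro ⟨c, hc⟩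
  obtain ⟨s₀, hs₀⟩ := inter_torusLocus_inter_ne_nonempty e hS.2 hne he
  by_cases hml : m (Fin.last d) = 0
  · set m' : Fin d → ℤ := fun i => m (Fin.castSucc i) with hm'
    refine hmul m' (castSucc_ne_zero_of_last_eq_zero hm hml) ⟨c, fun z hz => ?_⟩
    -- the cleared relation `∏ y^{m⁺} - c ∏ y^{(-m)⁺}` vanishes on `U`, hence on `S`
    set Q : MvPolynomial (Fin d ⊕ Fin d) ℂ :=
      (∏ i, X (Sum.inr i) ^ (m' i).toNat) - C c * ∏ i, X (Sum.inr i) ^ (-(m' i)).toNat with hQ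
    have hQeval : ∀ u : Fin d ⊕ Fin d → ℂ, aeval u Q =
        (∏ i, u (Sum.inr i) ^ (m' i).toNat) - c * ∏ i, u (Sum.inr i) ^ (-(m' i)).toNat := by
      intro u
      rw [hQ, map_sub, map_mul, aeval_C, map_prod, map_prod]
      simp only [map_pow, aeval_X]
      rfl
    have hQU : Q ∈ vanishingIdeal ℂ (S ∩ torusLocus ℂ d ∩ {s | MvPolynomial.eval s e ≠ 0}) := by
      rw [mem_vanishingIdeal_iff]
      intro u hu
      have h1 := hc _ (liftPt_mem_liftVar_inter_torusLocus e hu one_ne_zero)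
      rw [prod_liftPt_inr, hml, zpow_zero, mul_one] at h1
      rw [hQeval, ← prod_zpow_mul_prod_pow_eq m' hu.1.2, h1, sub_self]
    rw [vanishingIdeal_inter_torusLocus_inter_ne e hS.2 hne he] at hQU
    have h2 := (mem_vanishingIdeal_iff.1 hQU) z hz.1
    rw [hQeval, sub_eq_zero, ← prod_zpow_mul_prod_pow_eq m' hz.2] at h2
    have hD : (∏ i, z (Sum.inr i) ^ (-(m' i)).toNat) ≠ 0 :=
      Finset.prod_ne_zero_iff.2 fun i _ => pow_ne_zero _ (hz.2 i)
    exact mul_right_cancel₀ hD h2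
  · -- move `x_last`: `(e s₀)^{m_last} = (2 e s₀)^{m_last}` forces `2^{m_last} = 1`
    have h1 := hc _ (liftPt_mem_liftVar_inter_torusLocus e hs₀ one_ne_zero)
    have h2 := hc _ (liftPt_mem_liftVar_inter_torusLocus e hs₀ two_ne_zero)
    rw [prod_liftPt_inr, one_mul] at h1
    rw [prod_liftPt_inr, mul_zpow, mul_comm ((2 : ℂ) ^ _), ← mul_assoc] at h2
    have hP : (∏ i : Fin d, s₀ (Sum.inr i) ^ m (Fin.castSucc i)) *
        MvPolynomial.eval s₀ e ^ m (Fin.last d) ≠ 0 := by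
      refine mul_ne_zero (Finset.prod_ne_zero_iff.2 fun i _ => zpow_ne_zero _ (hs₀.1.2 i)) ?_
      exact zpow_ne_zero _ hs₀.2
    rw [← h1] at h2
    have h3 : (2 : ℂ) ^ m (Fin.last d) = 1 := by
      have := h2
      nth_rw 2 [← mul_one ((∏ i : Fin d, s₀ (Sum.inr i) ^ m (Fin.castSucc i)) *
        MvPolynomial.eval s₀ e ^ m (Fin.last d))] at this
      exact mul_left_cancel₀ hP this
    have h4 : (2 : ℝ) ^ m (Fin.last d) = (2 : ℝ) ^ (0 : ℤ) := by
      have := congrArg (fun z : ℂ => ‖z‖) h3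
      simp only [norm_zpow, Complex.norm_ofNat, norm_one] at this
      rw [this, zpow_zero]
    exact hml (zpow_right_injective₀ (by norm_num) (by norm_num) h4)

end Summit.Schanuel.Schanuel.Theorems
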